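import Summits.CriticalPhenomena.PercolationContinuityZ3.Theses.PercNearOneGluing
import Literature.Probability.LatticeModels.ProdBernoulliIndependence
import Summits.CriticalPhenomena.PercolationContinuityZ3.Theorems.PercNearOneGluingNoHeavyLowerTailHalfLeSevenForms
import Summits.CriticalPhenomena.PercolationContinuityZ3.Theorems.PercTorusSliceFillingSliceFillingUpperBoundWindow

/-!
# The linear-form constant of `NoHeavyLowerTail` cannot go below `1`

Negative (tightness) lemma for the crux `NoHeavyLowerTail` (stmt-CriticalPhenomena-4575) of the
route `PercNearOneGluing`.  The crux work file `Cruxes/NoHeavyLowerTail/Disproof.lean` reduces the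
crux to the `λ`-uniform *linear form*
`P(1 ≤ N < EN/2) ≤ C · (P(o ↮ A) + max_{a,a'} P(a ↮ a'))` (its `of_linearForm`) and derives the
linear form with `C = 3` from `AdditiveGluing` (stmt-4576).  This file records the matching LOWER
bound, self-contained (the rate family `R_{m,η}` below is copied from that work file, which a
`Theorems/` module may not import): **every constant `C` for which the linear form holds satisfies
`1 ≤ C`** (`one_le_of_linearForm`).  Witness `R_{5,1/2}`: `o —1— v1 —(1/2)— v2 —1— {5 leaves}`,
`A = univ \ {o}`: `P(o ↮ A) = 0`, `max P(a ↮ a') = 1/2`, `EN ≥ 5/2 > 2` and `P(N = 1) ≥ 1/2`, so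
the ratio is `≥ 1`.

Context (refuter census, job ids on the item): on all connected simple graphs with `≤ 9`
vertices and uniform rational edge weights, and under annealing over arbitrary weights on
`K₆ … K₉`, the linear-form ratio never exceeded `1` (supremum `1`, approached only in degenerate
pocket limits).  So the conjectural sharp constant is exactly `C = 1`; `C = 3` is what
`AdditiveGluing` gives. [folklore]
-/

namespace Summit.CriticalPhenomena.PercolationContinuityZ3.Theorems.NoHeavyLowerTail.Negative.LinearFormTight

open MeasureTheory Literature.Probability.LatticeModels Literature.Probability.Percolation





section RateWitness

/-! ## The rate family `R_{m,η}` (copied from `Cruxes/NoHeavyLowerTail/Disproof.lean`) -/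

variable (m : ℕ)

/-- The root `o`. -/
def v0 : Fin (m + 3) := ⟨0, by omega⟩
/-- The private finger `a₁`. -/
def v1 : Fin (m + 3) := ⟨1, by omega⟩
/-- The hub `a₂`. -/
def v2 : Fin (m + 3) := ⟨2, by omega⟩

/-- The root has index `0`. [folklore] -/
@[simp] theorem v0_val : (v0 m).val = 0 := rfl
/-- The finger has index `1`. [folklore] -/
@[simp] theorem v1_val : (v1 m).val = 1 := rfl
/-- The hub has index `2`. [folklore] -/
@[simp] theorem v2_val : (v2 m).val = 2 := rfl

/-- Hub edges `v2 — j`, `j ≥ 3`. -/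
def IsHub (e : Sym2 (Fin (m + 3))) : Prop := ∃ j : Fin (m + 3), 3 ≤ j.val ∧ e = s(v2 m, j)

/-- Decidability of the hub-edge predicate. [folklore] -/
instance : DecidablePred (IsHub m) := fun e => by unfold IsHub; infer_instance


/-- The hub leaves, as an explicit image of `Fin m` (so that the cardinality is `m`). -/
def leaves : Finset (Fin (m + 3)) :=
  (Finset.univ : Finset (Fin m)).image fun i => ⟨i.val + 3, by omega⟩

/-- There are exactly `m` hub leaves. [folklore] -/
theorem card_leaves : (leaves m).card = m := by
  rw [leaves, Finset.card_image_of_injective _ fun i j hij => ?_]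
  · simp
  · simp [Fin.ext_iff] at hij; exact Fin.ext hij

/-- Hub leaves have index `≥ 3`. [folklore] -/
theorem three_le_of_mem_leaves {j : Fin (m + 3)} (hj : j ∈ leaves m) : 3 ≤ j.val := by
  simp only [leaves, Finset.mem_image, Finset.mem_univ, true_and] at hj
  obtain ⟨i, rfl⟩ := hj
  simp



/-! The rate witness `R_{m,η}`: the chain `o = v0 —(1)— v1 —(1−η)— v2` and `m` hub leaves
`v2 —(1)— j` (`j ≥ 3`), all other pairs `0`; `A = univ \ {v0}`. The relay set is pairwise
`(1−η)`-reliable, `P(o ↔ A) = 1`, and `N = 1` exactly when the edge `v1 v2` is closed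
(probability `η`), while `EN ≥ m (1 − η)`. -/

variable (η : ℝ) (hη : η ∈ Set.Icc (0 : ℝ) 1)

/-- The weights of the rate witness. -/
noncomputable def wtR (m : ℕ) (η : ℝ) (hη : η ∈ Set.Icc (0 : ℝ) 1) (e : Sym2 (Fin (m + 3))) :
    unitInterval :=
  if e = s(v0 m, v1 m) then 1
  else if e = s(v1 m, v2 m) then ⟨1 - η, by constructor <;> linarith [hη.1, hη.2]⟩
  else if IsHub m e then 1 else 0

/-- Weight of the finger edge `v0 v1` is `1`. [folklore] -/
theorem wtR_01 : ((wtR m η hη s(v0 m, v1 m) : unitInterval) : ℝ) = 1 := by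
  simp [wtR]

/-- Weight of the switch edge `v1 v2` is `1 − η`. [folklore] -/
theorem wtR_12 : ((wtR m η hη s(v1 m, v2 m) : unitInterval) : ℝ) = 1 - η := by
  have h : ¬ (s(v1 m, v2 m) : Sym2 (Fin (m + 3))) = s(v0 m, v1 m) := by
    simp only [Sym2.eq_iff, Fin.ext_iff, v0_val, v1_val, v2_val]; omega
  simp [wtR, h]

/-- Weight of a hub edge is `1`. [folklore] -/
theorem wtR_hub (j : Fin (m + 3)) (hj : 3 ≤ j.val) :
    ((wtR m η hη s(v2 m, j) : unitInterval) : ℝ) = 1 := by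
  have h1 : ¬ (s(v2 m, j) : Sym2 (Fin (m + 3))) = s(v0 m, v1 m) := by
    simp only [Sym2.eq_iff, Fin.ext_iff, v0_val, v1_val, v2_val]; omega
  have h2 : ¬ (s(v2 m, j) : Sym2 (Fin (m + 3))) = s(v1 m, v2 m) := by
    simp only [Sym2.eq_iff, Fin.ext_iff, v1_val, v2_val]; omega
  have h3 : IsHub m s(v2 m, j) := ⟨j, hj, rfl⟩
  simp [wtR, h1, h2, h3]

/-- All other pairs at `v0` have weight `0`. [folklore] -/
theorem wtR_v0 (y : Fin (m + 3)) (hy : 2 ≤ y.val) : wtR m η hη s(v0 m, y) = 0 := by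
  have h1 : ¬ (s(v0 m, y) : Sym2 (Fin (m + 3))) = s(v0 m, v1 m) := by
    simp only [Sym2.eq_iff, Fin.ext_iff, v0_val, v1_val]; omega
  have h2 : ¬ (s(v0 m, y) : Sym2 (Fin (m + 3))) = s(v1 m, v2 m) := by
    simp only [Sym2.eq_iff, Fin.ext_iff, v0_val, v1_val, v2_val]; omega
  have h3 : ¬ IsHub m s(v0 m, y) := by
    rintro ⟨j, hj, hji⟩
    simp only [Sym2.eq_iff, Fin.ext_iff, v0_val, v2_val] at hji; omega
  simp [wtR, h1, h2, h3]

/-- All other pairs at `v1` have weight `0`. [folklore] -/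
theorem wtR_v1 (y : Fin (m + 3)) (hy : 3 ≤ y.val) : wtR m η hη s(v1 m, y) = 0 := by
  have h1 : ¬ (s(v1 m, y) : Sym2 (Fin (m + 3))) = s(v0 m, v1 m) := by
    simp only [Sym2.eq_iff, Fin.ext_iff, v0_val, v1_val]; omega
  have h2 : ¬ (s(v1 m, y) : Sym2 (Fin (m + 3))) = s(v1 m, v2 m) := by
    simp only [Sym2.eq_iff, Fin.ext_iff, v1_val, v2_val]; omega
  have h3 : ¬ IsHub m s(v1 m, y) := by
    rintro ⟨j, hj, hji⟩
    simp only [Sym2.eq_iff, Fin.ext_iff, v1_val, v2_val] at hji; omega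
  simp [wtR, h1, h2, h3]

/-- The backbone edges: `v1 v2` and the hub edges. -/
def backbone : Finset (Sym2 (Fin (m + 3))) :=
  insert s(v1 m, v2 m) ((leaves m).image fun j => s(v2 m, j))

/-- The backbone is open with probability `1 − η`. [folklore] -/
theorem prob_backbone :
    (prodBernoulli (wtR m η hη)).real {ω | ((backbone m : Finset _) : Set (Sym2 (Fin (m + 3)))) ⊆ ω}
      = 1 - η := by
  rw [prodBernoulli_real_subset, backbone, Finset.prod_insert, wtR_12, Finset.prod_eq_one, mul_one]
  · intro e he
    simp only [Finset.mem_image] at he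
    obtain ⟨j, hj, rfl⟩ := he
    exact wtR_hub m η hη j (three_le_of_mem_leaves m hj)
  · simp only [Finset.mem_image, not_exists, not_and]
    intro j hj h
    have := three_le_of_mem_leaves m hj
    simp only [Sym2.eq_iff, Fin.ext_iff, v1_val, v2_val] at h; omega

/-- On the backbone event every relay point is joined to the hub `v2`. -/
theorem reachable_v2_of_backbone {ω : Set (Sym2 (Fin (m + 3)))}
    (hω : ((backbone m : Finset _) : Set (Sym2 (Fin (m + 3)))) ⊆ ω) {a : Fin (m + 3)}
    (ha : a ≠ v0 m) : (openGraph ω).Reachable (v2 m) a := by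
  have h12 : s(v1 m, v2 m) ∈ ω := hω (by simp [backbone])
  by_cases h1 : a = v1 m
  · subst h1
    exact (SimpleGraph.Adj.reachable ((openGraph_adj ω _ _).2
      ⟨h12, fun h => by simp [Fin.ext_iff] at h⟩)).symm
  by_cases h2 : a = v2 m
  · subst h2; rfl
  · have h3 : 3 ≤ a.val := by
      have h0 : a.val ≠ 0 := fun h => ha (Fin.ext h)
      have h1' : a.val ≠ 1 := fun h => h1 (Fin.ext h)
      have h2' : a.val ≠ 2 := fun h => h2 (Fin.ext h)
      omega
    have hmem : s(v2 m, a) ∈ ω := by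
      refine hω ?_
      simp only [backbone, Finset.coe_insert, Finset.coe_image, Set.mem_insert_iff, Set.mem_image,
        Finset.mem_coe, leaves, Finset.mem_univ, true_and]
      refine Or.inr ⟨a, ⟨⟨a.val - 3, by omega⟩, Fin.ext (by simp; omega)⟩, rfl⟩
    exact SimpleGraph.Adj.reachable ((openGraph_adj ω _ _).2
      ⟨hmem, fun h => by rw [← h] at h3; simp at h3⟩)

/-- Pairwise reliability of `A = univ \ {v0}`: `1 − η ≤ P(a ↔ a')`. -/
theorem pair_geR {a a' : Fin (m + 3)} (ha : a ≠ v0 m) (ha' : a' ≠ v0 m) :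
    1 - η ≤ (prodBernoulli (wtR m η hη)).real (openConn a a') := by
  rw [← prob_backbone m η hη]
  refine measureReal_mono (fun ω hω => ?_) (measure_ne_top _ _)
  exact (reachable_v2_of_backbone m hω ha).symm.trans (reachable_v2_of_backbone m hω ha')

/-- Lower bound on the mean: `m (1 − η) ≤ EN`. -/
theorem mean_geR : (m : ℝ) * (1 - η) ≤
    ∑ a ∈ Finset.univ.erase (v0 m), (prodBernoulli (wtR m η hη)).real (openConn (v0 m) a) := by
  set P := prodBernoulli (wtR m η hη) with hP
  have hsub : leaves m ⊆ Finset.univ.erase (v0 m) := by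
    intro j hj
    have := three_le_of_mem_leaves m hj
    exact Finset.mem_erase.2 ⟨fun h => by rw [h] at this; simp at this, Finset.mem_univ _⟩
  have hF : P.real {ω | (((insert s(v0 m, v1 m) (backbone m) : Finset _)) :
      Set (Sym2 (Fin (m + 3)))) ⊆ ω} = 1 - η := by
    rw [hP, prodBernoulli_real_subset, Finset.prod_insert, wtR_01, one_mul,
      ← prodBernoulli_real_subset, prob_backbone]
    simp only [backbone, Finset.mem_insert, Finset.mem_image, not_or, not_exists, not_and]
    refine ⟨fun h => ?_, fun j hj h => ?_⟩
    · simp only [Sym2.eq_iff, Fin.ext_iff, v0_val, v1_val, v2_val] at h; omega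
    · simp only [Sym2.eq_iff, Fin.ext_iff, v0_val, v1_val, v2_val] at h; omega
  have hleaf : ∀ j ∈ leaves m, 1 - η ≤ P.real (openConn (v0 m) j) := by
    intro j hj
    rw [← hF]
    refine measureReal_mono (fun ω hω => ?_) (measure_ne_top _ _)
    simp only [Finset.coe_insert, Set.mem_setOf_eq, Set.insert_subset_iff] at hω
    have h01 : (openGraph ω).Adj (v0 m) (v1 m) :=
      (openGraph_adj ω _ _).2 ⟨hω.1, fun h => by simp [Fin.ext_iff] at h⟩
    have hj0 : j ≠ v0 m := fun h => by
      have := three_le_of_mem_leaves m hj; rw [h] at this; simp at this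
    exact h01.reachable.trans ((reachable_v2_of_backbone m hω.2 (a := v1 m)
      (fun h => by simp [Fin.ext_iff] at h)).symm.trans (reachable_v2_of_backbone m hω.2 hj0))
  calc (m : ℝ) * (1 - η) = ∑ j ∈ leaves m, (1 - η) := by simp [card_leaves]; ring
    _ ≤ ∑ j ∈ leaves m, P.real (openConn (v0 m) j) := Finset.sum_le_sum hleaf
    _ ≤ _ := Finset.sum_le_sum_of_subset_of_nonneg hsub fun _ _ _ => measureReal_nonneg

/-- The good event of the rate witness: finger open, `v1 v2` closed, weight-zero pairs closed. -/
def goodR : Set (Set (Sym2 (Fin (m + 3)))) :=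
  {ω | s(v0 m, v1 m) ∈ ω ∧ s(v1 m, v2 m) ∉ ω ∧
    ∀ e ∈ (Finset.univ.filter fun e => wtR m η hη e = 0), e ∉ ω}

/-- `η ≤ P(goodR)`. -/
theorem le_goodR : η ≤ (prodBernoulli (wtR m η hη)).real (goodR m η hη) := by
  set P := prodBernoulli (wtR m η hη) with hP
  have hc : P.real (goodR m η hη)ᶜ ≤ 1 - η := by
    have hsub : (goodR m η hη)ᶜ ⊆ ({ω | s(v0 m, v1 m) ∉ ω} ∪ {ω | s(v1 m, v2 m) ∈ ω}) ∪
        {ω | ∃ e ∈ (Finset.univ.filter fun e => wtR m η hη e = 0), e ∈ ω} := by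
      intro ω hω
      simp only [goodR, Set.mem_compl_iff, Set.mem_setOf_eq, not_and, not_forall, not_not] at hω
      simp only [Set.mem_union, Set.mem_setOf_eq]
      by_cases h1 : s(v0 m, v1 m) ∈ ω
      · by_cases h2 : s(v1 m, v2 m) ∈ ω
        · exact Or.inl (Or.inr h2)
        · obtain ⟨e, he, hee⟩ := hω h1 h2
          exact Or.inr ⟨e, he, hee⟩
      · exact Or.inl (Or.inl h1)
    calc P.real (goodR m η hη)ᶜ
        ≤ P.real (({ω | s(v0 m, v1 m) ∉ ω} ∪ {ω | s(v1 m, v2 m) ∈ ω}) ∪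
            {ω | ∃ e ∈ (Finset.univ.filter fun e => wtR m η hη e = 0), e ∈ ω}) :=
          measureReal_mono hsub
      _ ≤ (P.real {ω | s(v0 m, v1 m) ∉ ω} + P.real {ω | s(v1 m, v2 m) ∈ ω}) +
            P.real {ω | ∃ e ∈ (Finset.univ.filter fun e => wtR m η hη e = 0), e ∈ ω} :=
          le_trans (measureReal_union_le _ _) (add_le_add (measureReal_union_le _ _) le_rfl)
      _ ≤ ((1 - 1) + (1 - η)) + 0 := by
          gcongr
          · rw [hP, prodBernoulli_real_setOf_notMem, wtR_01]
          · rw [hP, prodBernoulli_real_setOf_mem, wtR_12]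
          · refine le_trans (prodBernoulli_real_exists_mem_le_sum _ _) (le_of_eq ?_)
            refine Finset.sum_eq_zero fun e he => ?_
            simp only [Finset.mem_filter, Finset.mem_univ, true_and] at he
            simp [he]
      _ = 1 - η := by ring
  rw [probReal_compl_eq_one_sub (halfLeSevenForms_measurableSet_config _)] at hc
  linarith

/-- On `goodR`, the cluster of `o = v0` meets `A` exactly in `{v1}`. -/
theorem filter_eq_of_goodR {ω : Set (Sym2 (Fin (m + 3)))} (hω : ω ∈ goodR m η hη)
    [DecidablePred fun a => ω ∈ openConn (v0 m) a] :
    (Finset.univ.erase (v0 m)).filter (fun a => ω ∈ openConn (v0 m) a) = {v1 m} := by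
  obtain ⟨h01, h12, hzero⟩ := hω
  have hzero' : ∀ e, wtR m η hη e = 0 → e ∉ ω := fun e he =>
    hzero e (Finset.mem_filter.2 ⟨Finset.mem_univ _, he⟩)
  have hT : ∀ x y, x ∈ ({v0 m, v1 m} : Set (Fin (m + 3))) → (openGraph ω).Adj x y →
      y ∈ ({v0 m, v1 m} : Set (Fin (m + 3))) := by
    intro x y hx hxy
    rw [openGraph_adj] at hxy
    obtain ⟨hmem, hne⟩ := hxy
    by_contra hy
    simp only [Set.mem_insert_iff, Set.mem_singleton_iff, not_or] at hy
    have hy2 : 2 ≤ y.val := by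
      rcases Nat.lt_or_ge y.val 2 with h | h
      · exfalso
        interval_cases hv : y.val
        · exact hy.1 (Fin.ext hv)
        · exact hy.2 (Fin.ext hv)
      · exact h
    rcases hx with rfl | rfl
    · exact hzero' _ (wtR_v0 m η hη y hy2) hmem
    · rcases Nat.lt_or_ge y.val 3 with h3 | h3
      · have : y = v2 m := Fin.ext (by simp; omega)
        subst this
        exact h12 hmem
      · exact hzero' _ (wtR_v1 m η hη y h3) hmem
  ext a
  simp only [Finset.mem_filter, Finset.mem_erase, Finset.mem_univ, and_true,
    Finset.mem_singleton]
  constructor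
  · rintro ⟨ha0, hreach⟩
    have hmemT := SliceFilling.mem_of_reachable_of_closed hT hreach (by simp)
    simp only [Set.mem_insert_iff, Set.mem_singleton_iff] at hmemT
    exact hmemT.resolve_left ha0
  · rintro rfl
    refine ⟨fun h => by simp [Fin.ext_iff] at h, ?_⟩
    exact SimpleGraph.Adj.reachable ((openGraph_adj ω _ _).2 ⟨h01, fun h => by simp [Fin.ext_iff] at h⟩)


end RateWitness

open scoped Classical in
/-- **Tightness of the linear form: any admissible constant is `≥ 1`.**  If
`P(1 ≤ N < EN/2) ≤ C · (P(o ↮ A) + η)` holds for all finite weighted graphs, all `A`, `o` and every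
common upper bound `η ≥ 0` of the pairwise disconnection probabilities of `A` (this is
`LinearForm C` of `Cruxes/NoHeavyLowerTail/Disproof.lean`, expanded), then `1 ≤ C`.  Witness: the
rate family `R_{5,1/2}` (`wtR 5 (1/2)`), `o = v0`, `A = univ \ {v0}`, `η = 1/2`. [folklore] -/
theorem one_le_of_linearForm {C : ℝ}
    (hL : ∀ (n : ℕ) (w : Sym2 (Fin n) → unitInterval) (A : Finset (Fin n)) (o : Fin n) (η : ℝ),
      0 ≤ η → (∀ a ∈ A, ∀ a' ∈ A, (prodBernoulli w).real (openConn a a')ᶜ ≤ η) →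
        (prodBernoulli w).real {ω | 1 ≤ (A.filter fun a => ω ∈ openConn o a).card ∧
          ((A.filter fun a => ω ∈ openConn o a).card : ℝ) <
            (∑ a ∈ A, (prodBernoulli w).real (openConn o a)) / 2} ≤
          C * ((prodBernoulli w).real (⋃ a ∈ A, openConn o a)ᶜ + η)) :
    1 ≤ C := by
  have hη : (1 / 2 : ℝ) ∈ Set.Icc (0 : ℝ) 1 := ⟨by norm_num, by norm_num⟩
  set P := prodBernoulli (wtR 5 (1 / 2) hη) with hP
  -- pairwise reliability, in complement form
  have hpair : ∀ a ∈ Finset.univ.erase (v0 5), ∀ a' ∈ Finset.univ.erase (v0 5),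
      P.real (openConn a a')ᶜ ≤ 1 / 2 := by
    intro a ha a' ha'
    have h := pair_geR 5 (1 / 2) hη (Finset.mem_erase.1 ha).1 (Finset.mem_erase.1 ha').1
    rw [probReal_compl_eq_one_sub (halfLeSevenForms_measurableSet_config _)]
    rw [← hP] at h
    linarith
  -- `P(o ↮ A) = 0`
  have hunion : P.real (⋃ a ∈ Finset.univ.erase (v0 5), openConn (v0 5) a)ᶜ = 0 := by
    have h1 : P.real {ω | s(v0 5, v1 5) ∈ ω} = 1 := by
      rw [hP, prodBernoulli_real_setOf_mem, wtR_01]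
    have hle : (1 : ℝ) ≤ P.real (⋃ a ∈ Finset.univ.erase (v0 5), openConn (v0 5) a) := by
      rw [← h1]
      refine measureReal_mono (fun ω hω => ?_) (measure_ne_top _ _)
      simp only [Set.mem_setOf_eq] at hω
      simp only [Set.mem_iUnion, exists_prop, Finset.mem_erase, Finset.mem_univ, and_true]
      refine ⟨v1 5, fun h => by simp [Fin.ext_iff] at h, ?_⟩
      exact SimpleGraph.Adj.reachable ((openGraph_adj ω _ _).2
        ⟨hω, fun h => by simp [Fin.ext_iff] at h⟩)
    have hle1 : P.real (⋃ a ∈ Finset.univ.erase (v0 5), openConn (v0 5) a) ≤ 1 :=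
      measureReal_le_one
    rw [probReal_compl_eq_one_sub (halfLeSevenForms_measurableSet_config _)]
    linarith
  -- the bad event has probability `≥ 1/2`
  have hbad : (1 / 2 : ℝ) ≤ P.real {ω | 1 ≤ ((Finset.univ.erase (v0 5)).filter
      fun a => ω ∈ openConn (v0 5) a).card ∧
      (((Finset.univ.erase (v0 5)).filter fun a => ω ∈ openConn (v0 5) a).card : ℝ) <
        (∑ a ∈ Finset.univ.erase (v0 5), P.real (openConn (v0 5) a)) / 2} := by
    refine le_trans (le_goodR 5 (1 / 2) hη) (measureReal_mono (fun ω hω => ?_) (measure_ne_top _ _))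
    have hmean := mean_geR 5 (1 / 2) hη
    rw [← hP] at hmean
    simp only [Set.mem_setOf_eq]
    rw [filter_eq_of_goodR 5 (1 / 2) hη hω, Finset.card_singleton]
    refine ⟨le_rfl, ?_⟩
    push_cast at hmean ⊢
    linarith
  have key := hL (5 + 3) (wtR 5 (1 / 2) hη) (Finset.univ.erase (v0 5)) (v0 5) (1 / 2)
    (by norm_num) hpair
  rw [← hP] at key
  rw [hunion, zero_add] at key
  nlinarith [hbad.trans key]

end Summit.CriticalPhenomena.PercolationContinuityZ3.Theorems.NoHeavyLowerTail.Negative.LinearFormTight
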